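import Mathlib
import Literature.Probability.Percolation.SmoothedWhiteNoise
import Literature.MathematicalPhysics.QuantumFieldTheory.GaussianFieldOfCovariance

/-!
# White noise on `ℂ`: laws of evaluations, covariances, independence, tails

Helper file for item `NoiseDiscretisation` (stmt-CriticalPhenomena-4598) of route
`CardyWhiteToColoured` (`CardyFormulaZ2`). For a white noise `μ` on `𝒮'(ℂ)` (`IsWhiteNoise μ`:
centred Gaussian field with generating functional `exp(−½‖f‖²_{L²})`, Glimm–Jaffe §6.2) we record
the elementary Gaussian calculus of the evaluations `ω ↦ ω f`, `f ∈ 𝓢(ℂ, ℝ)`, used by the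
coupling and the no-atom arguments of the item:

* `ω f ~ N(0, ∫ f²)` (`map_eval_eq_gaussianReal`, from the tree's
  `map_eval_eq_gaussianReal_of_genFunctional`), `∫ (ω f)² dμ = ∫ f²`, `∫ ω f dμ = 0`;
* finite families of evaluations are jointly Gaussian (`hasGaussianLaw_pi`: image of the Gaussian
  measure `μ` under the continuous linear map `ω ↦ (ω fᵢ)ᵢ`);
* the covariance is the `L²` inner product, `cov(ω f, ω g) = ∫ f g` (polarisation);
* evaluations at pairwise `L²`-orthogonal test functions are independent
  (`iIndepFun_eval_of_orthogonal`, Mathlib's `HasGaussianLaw.iIndepFun_of_covariance_eq_zero` on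
  finite sub-families), hence an orthonormal sequence of test functions is mapped to the product
  of standard Gaussians (`map_pi_eval_eq_infinitePi`);
* the two-sided Gaussian tail bound `μ{|ω f| ≥ η} ≤ 2 exp(−η²/(2v))` whenever `∫ f² ≤ v`
  (Chernoff, `measure_ge_le_exp_mul_mgf`, `mgf_gaussianReal`).

References: J. Glimm, A. Jaffe, *Quantum Physics* (1987), §6.2; I. M. Gel'fand, N. Ya. Vilenkin,
*Generalized Functions IV* (1964), Ch. III §2 (Gaussian generalised random fields).
-/

noncomputable section

namespace Summit.CriticalPhenomena.CardyFormulaZ2.Theorems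

namespace WhiteToColoured

open Set MeasureTheory ProbabilityTheory Real Filter Topology
open Literature.Probability.Percolation
open Literature.MathematicalPhysics.QuantumLattice
open Literature.MathematicalPhysics.QuantumFieldTheory

variable {μ : Measure (FieldConfig ℂ)}

/-- A white noise is a probability measure. -/
theorem wn_isProbabilityMeasure (h : IsWhiteNoise μ) : IsProbabilityMeasure μ :=
  h.1.1.toIsProbabilityMeasure

/-- Evaluations are integrable under a white noise. -/
theorem wn_integrable_eval (h : IsWhiteNoise μ) (f : SchwartzMap ℂ ℝ) :
    Integrable (fun ω : FieldConfig ℂ => ω f) μ :=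
  (h.1.2 f).1

/-- Evaluations are centred under a white noise. -/
theorem wn_integral_eval (h : IsWhiteNoise μ) (f : SchwartzMap ℂ ℝ) :
    ∫ ω : FieldConfig ℂ, ω f ∂μ = 0 :=
  (h.1.2 f).2

/-- The variance of an evaluation is the squared `L²` norm: `∫ (ω f)² dμ = ∫ f²`. -/
theorem wn_integral_sq_eval (h : IsWhiteNoise μ) (f : SchwartzMap ℂ ℝ) :
    ∫ ω : FieldConfig ℂ, (ω f) ^ 2 ∂μ = ∫ z, f z ^ 2 :=
  integral_sq_eval_of_genFunctional_eq h.1 (fun f => ∫ z, f z ^ 2) h.2 f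

/-- The law of an evaluation: `ω f ~ N(0, ∫ f²)`. -/
theorem wn_map_eval_eq_gaussianReal (h : IsWhiteNoise μ) (f : SchwartzMap ℂ ℝ) :
    μ.map (fun ω : FieldConfig ℂ => ω f) = gaussianReal 0 (∫ z, f z ^ 2).toNNReal := by
  haveI := wn_isProbabilityMeasure h
  refine map_eval_eq_gaussianReal_of_genFunctional (fun f => ∫ z, f z ^ 2)
    (fun f => integral_nonneg fun z => sq_nonneg _) (fun t f => ?_) h.2 f
  simp only [smul_apply, smul_eq_mul, mul_pow, integral_const_mul]

/-- Finite families of evaluations are jointly Gaussian under a Gaussian field. -/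
theorem hasGaussianLaw_pi (hμ : IsGaussianField μ) {ι : Type*} [Fintype ι]
    (f : ι → SchwartzMap ℂ ℝ) :
    HasGaussianLaw (fun (ω : FieldConfig ℂ) (i : ι) => ω (f i)) μ := by
  haveI := hμ.1
  set L : FieldConfig ℂ →L[ℝ] (ι → ℝ) :=
    ContinuousLinearMap.pi fun i => PointwiseConvergenceCLM.evalCLM (RingHom.id ℝ) ℝ (f i) with hL
  have hLm : Measurable L := measurable_pi_lambda _ fun i => measurable_eval (f i)
  have : IsGaussian (μ.map L) := isGaussian_map_of_measurable hLm
  exact ⟨this⟩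

/-- Evaluations are square integrable under a white noise. -/
theorem wn_memLp_eval (h : IsWhiteNoise μ) (f : SchwartzMap ℂ ℝ) :
    MemLp (fun ω : FieldConfig ℂ => ω f) 2 μ := by
  have := (hasGaussianLaw_pi h.1 (fun _ : Unit => f)).eval ()
  exact this.memLp_two

/-- The product of two Schwartz functions is integrable. -/
theorem integrable_mul_schwartz (f g : SchwartzMap ℂ ℝ) :
    Integrable (fun z => f z * g z) := by
  have hf : MemLp f 2 volume := f.memLp 2 volume
  have hg : MemLp g 2 volume := g.memLp 2 volume
  exact hf.integrable_mul hg

/-- **Covariance of white noise**: `∫ ω f · ω g dμ = ∫ f g` (polarisation of the variance). -/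
theorem wn_integral_eval_mul_eval (h : IsWhiteNoise μ) (f g : SchwartzMap ℂ ℝ) :
    ∫ ω : FieldConfig ℂ, ω f * ω g ∂μ = ∫ z, f z * g z := by
  have h1 := wn_integral_sq_eval h (f + g)
  have h2 := wn_integral_sq_eval h (f - g)
  simp only [map_add, map_sub, add_apply, sub_apply] at h1 h2
  have hf2 := wn_memLp_eval h f
  have hg2 := wn_memLp_eval h g
  have hprod : Integrable (fun ω : FieldConfig ℂ => ω f * ω g) μ := hf2.integrable_mul hg2
  have hff : Integrable (fun ω : FieldConfig ℂ => ω f * ω f) μ := hf2.integrable_mul hf2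
  have hgg : Integrable (fun ω : FieldConfig ℂ => ω g * ω g) μ := hg2.integrable_mul hg2
  -- expand both sides
  have e1 : ∫ ω : FieldConfig ℂ, (ω f + ω g) ^ 2 ∂μ =
      (∫ ω : FieldConfig ℂ, ω f * ω f ∂μ) + 2 * (∫ ω : FieldConfig ℂ, ω f * ω g ∂μ) +
        ∫ ω : FieldConfig ℂ, ω g * ω g ∂μ := by
    have : (fun ω : FieldConfig ℂ => (ω f + ω g) ^ 2) =
        fun ω => (ω f * ω f + 2 * (ω f * ω g)) + ω g * ω g := by funext ω; ring
    rw [this, integral_add (f := fun ω : FieldConfig ℂ => ω f * ω f + 2 * (ω f * ω g))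
        (g := fun ω : FieldConfig ℂ => ω g * ω g) (hff.add (hprod.const_mul 2)) hgg,
      integral_add (f := fun ω : FieldConfig ℂ => ω f * ω f)
        (g := fun ω : FieldConfig ℂ => 2 * (ω f * ω g)) hff (hprod.const_mul 2),
      integral_const_mul]
  have e2 : ∫ ω : FieldConfig ℂ, (ω f - ω g) ^ 2 ∂μ =
      (∫ ω : FieldConfig ℂ, ω f * ω f ∂μ) - 2 * (∫ ω : FieldConfig ℂ, ω f * ω g ∂μ) +
        ∫ ω : FieldConfig ℂ, ω g * ω g ∂μ := by
    have : (fun ω : FieldConfig ℂ => (ω f - ω g) ^ 2) =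
        fun ω => (ω f * ω f - 2 * (ω f * ω g)) + ω g * ω g := by funext ω; ring
    rw [this, integral_add (f := fun ω : FieldConfig ℂ => ω f * ω f - 2 * (ω f * ω g))
        (g := fun ω : FieldConfig ℂ => ω g * ω g) (hff.sub (hprod.const_mul 2)) hgg,
      integral_sub (f := fun ω : FieldConfig ℂ => ω f * ω f)
        (g := fun ω : FieldConfig ℂ => 2 * (ω f * ω g)) hff (hprod.const_mul 2),
      integral_const_mul]
  have hfg : Integrable (fun z => f z * g z) := integrable_mul_schwartz f g
  have hffz : Integrable (fun z => f z * f z) := integrable_mul_schwartz f f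
  have hggz : Integrable (fun z => g z * g z) := integrable_mul_schwartz g g
  have e3 : ∫ z, (f z + g z) ^ 2 = (∫ z, f z * f z) + 2 * (∫ z, f z * g z) + ∫ z, g z * g z := by
    have : (fun z => (f z + g z) ^ 2) = fun z => (f z * f z + 2 * (f z * g z)) + g z * g z := by
      funext z; ring
    rw [this, integral_add (f := fun z => f z * f z + 2 * (f z * g z)) (g := fun z => g z * g z)
        (hffz.add (hfg.const_mul 2)) hggz,
      integral_add (f := fun z => f z * f z) (g := fun z => 2 * (f z * g z)) hffz (hfg.const_mul 2),
      integral_const_mul]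
  have e4 : ∫ z, (f z - g z) ^ 2 = (∫ z, f z * f z) - 2 * (∫ z, f z * g z) + ∫ z, g z * g z := by
    have : (fun z => (f z - g z) ^ 2) = fun z => (f z * f z - 2 * (f z * g z)) + g z * g z := by
      funext z; ring
    rw [this, integral_add (f := fun z => f z * f z - 2 * (f z * g z)) (g := fun z => g z * g z)
        (hffz.sub (hfg.const_mul 2)) hggz,
      integral_sub (f := fun z => f z * f z) (g := fun z => 2 * (f z * g z)) hffz (hfg.const_mul 2),
      integral_const_mul]
  linarith

/-- **Covariance of white noise** in Mathlib's `covariance`: `cov(ω f, ω g) = ∫ f g`. -/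
theorem wn_covariance_eval (h : IsWhiteNoise μ) (f g : SchwartzMap ℂ ℝ) :
    cov[fun ω : FieldConfig ℂ => ω f, fun ω : FieldConfig ℂ => ω g; μ] = ∫ z, f z * g z := by
  haveI := wn_isProbabilityMeasure h
  rw [covariance_eq_sub (wn_memLp_eval h f) (wn_memLp_eval h g)]
  simp only [Pi.mul_apply, wn_integral_eval h, mul_zero, sub_zero]
  exact wn_integral_eval_mul_eval h f g

/-- **Independence of evaluations at orthogonal test functions** under a white noise. -/
theorem wn_iIndepFun_eval_of_orthogonal (h : IsWhiteNoise μ) {ι : Type*}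
    (f : ι → SchwartzMap ℂ ℝ) (horth : ∀ i j, i ≠ j → ∫ z, f i z * f j z = 0) :
    iIndepFun (fun i (ω : FieldConfig ℂ) => ω (f i)) μ := by
  classical
  rw [iIndepFun_iff_finset]
  intro s
  refine HasGaussianLaw.iIndepFun_of_covariance_eq_zero (hasGaussianLaw_pi h.1 fun i : s => f i)
    fun i j hij => ?_
  show cov[fun ω : FieldConfig ℂ => ω (f i), fun ω : FieldConfig ℂ => ω (f j); μ] = 0
  rw [wn_covariance_eval h]
  exact horth i j fun hh => hij (Subtype.ext hh)

/-- **An orthonormal sequence of test functions is mapped by a white noise to i.i.d. standard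
Gaussians**: the law of `ω ↦ (ω fᵢ)ᵢ` is the product measure `⨂ᵢ N(0, 1)`. -/
theorem wn_map_pi_eval_eq_infinitePi (h : IsWhiteNoise μ) {ι : Type*}
    (f : ι → SchwartzMap ℂ ℝ) (horth : ∀ i j, i ≠ j → ∫ z, f i z * f j z = 0)
    (hnorm : ∀ i, ∫ z, f i z ^ 2 = 1) :
    μ.map (fun (ω : FieldConfig ℂ) (i : ι) => ω (f i)) =
      Measure.infinitePi (fun _ : ι => gaussianReal 0 1) := by
  rw [(wn_iIndepFun_eval_of_orthogonal h f horth).map_fun_eq_infinitePi_map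
    (fun i => measurable_eval (f i))]
  congr 1
  funext i
  rw [wn_map_eval_eq_gaussianReal h, hnorm i]
  simp

/-- **Gaussian tail of an evaluation** (Chernoff): if `∫ f² ≤ v` then
`μ{η ≤ ω f} ≤ exp(−η²/(2v))` for `η ≥ 0`, `v > 0`. -/
theorem wn_measureReal_eval_ge_le (h : IsWhiteNoise μ) (f : SchwartzMap ℂ ℝ) {v η : ℝ}
    (hv : 0 < v) (hfv : ∫ z, f z ^ 2 ≤ v) (hη : 0 ≤ η) :
    μ.real {ω : FieldConfig ℂ | η ≤ ω f} ≤ exp (-η ^ 2 / (2 * v)) := by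
  haveI := wn_isProbabilityMeasure h
  have hlaw := wn_map_eval_eq_gaussianReal h f
  set t := η / v with ht
  have ht0 : 0 ≤ t := by positivity
  have hint : Integrable (fun ω : FieldConfig ℂ => exp (t * ω f)) μ := by
    have := integrable_exp_mul_gaussianReal (μ := 0) (v := (∫ z, f z ^ 2).toNNReal) t
    rw [← hlaw] at this
    exact (integrable_map_measure (by fun_prop) (measurable_eval f).aemeasurable).1 this
  refine (measure_ge_le_exp_mul_mgf η ht0 hint).trans ?_
  rw [mgf_gaussianReal hlaw t]
  have hs : ((∫ z, f z ^ 2).toNNReal : ℝ) = ∫ z, f z ^ 2 :=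
    Real.coe_toNNReal _ (integral_nonneg fun z => sq_nonneg _)
  rw [hs, ← Real.exp_add]
  apply Real.exp_le_exp.2
  have hss : 0 ≤ ∫ z, f z ^ 2 := integral_nonneg fun z => sq_nonneg _
  rw [ht]
  have key : (∫ z, f z ^ 2) * (η / v) ^ 2 / 2 ≤ v * (η / v) ^ 2 / 2 :=
    div_le_div_of_nonneg_right (mul_le_mul_of_nonneg_right hfv (sq_nonneg _)) (by norm_num)
  have heq : -(η / v) * η + (0 * (η / v) + v * (η / v) ^ 2 / 2) = -η ^ 2 / (2 * v) := by
    field_simp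
    ring
  linarith

/-- **Two-sided Gaussian tail of an evaluation**: if `∫ f² ≤ v` then
`μ{η ≤ |ω f|} ≤ 2 exp(−η²/(2v))` for `η ≥ 0`, `v > 0`. -/
theorem wn_measureReal_abs_eval_ge_le (h : IsWhiteNoise μ) (f : SchwartzMap ℂ ℝ)
    {v η : ℝ} (hv : 0 < v) (hfv : ∫ z, f z ^ 2 ≤ v) (hη : 0 ≤ η) :
    μ.real {ω : FieldConfig ℂ | η ≤ |ω f|} ≤ 2 * exp (-η ^ 2 / (2 * v)) := by
  haveI := wn_isProbabilityMeasure h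
  have hsub : {ω : FieldConfig ℂ | η ≤ |ω f|} ⊆
      {ω : FieldConfig ℂ | η ≤ ω f} ∪ {ω : FieldConfig ℂ | η ≤ ω (-f)} := by
    intro ω hω
    simp only [mem_setOf_eq, map_neg, mem_union] at hω ⊢
    rcases le_abs'.1 hω with h1 | h1
    · right; linarith
    · left; exact h1
  have h1 := wn_measureReal_eval_ge_le h f hv hfv hη
  have h2 := wn_measureReal_eval_ge_le h (-f) hv (by simpa using hfv) hη
  calc μ.real {ω : FieldConfig ℂ | η ≤ |ω f|}
      ≤ μ.real ({ω : FieldConfig ℂ | η ≤ ω f} ∪ {ω : FieldConfig ℂ | η ≤ ω (-f)}) :=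
        measureReal_mono hsub
    _ ≤ μ.real {ω : FieldConfig ℂ | η ≤ ω f} + μ.real {ω : FieldConfig ℂ | η ≤ ω (-f)} :=
        measureReal_union_le _ _
    _ ≤ 2 * exp (-η ^ 2 / (2 * v)) := by linarith

end WhiteToColoured

end Summit.CriticalPhenomena.CardyFormulaZ2.Theorems
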